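import Literature.NumberTheory.LFunctions.IwaniecSarnakFamilyWeightTwo
import Literature.NumberTheory.LFunctions.CentralValueFamilyDevices
import Literature.NumberTheory.EllipticCurves.NewformsRealCoefficients
import HarnessLib

/-!
# Even share of an AMPLIFIED harmonic measure `ω_f A_f²` at prime level, weight `2`
# (Kowalski–Michel 2000 Petersson facts; hypothesis `EvenShare` of the amplified edge implication)

Topic `Literature/NumberTheory/LFunctions` (namespace
`Literature.NumberTheory.LFunctions.CentralValueFamilyHalfEdge`). PROOFS only — NO named fact
(D-0026). Cell `landau-siegel`, §C typing for §B-fam / §D (amplified-measure designs; the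
«amplified even-mass denominator» of the reweighted family `iwaniecSarnakFamilyAmp 2 A` of
`CentralValueFamilyDevices`).

For an amplifier LINEAR IN HECKE EIGENVALUES, `A_N(f) = Σ_{ℓ ∈ S_N} c_{N,ℓ} · re λ_f(ℓ)` (`λ_f(ℓ)` the
tree's `GL2Family.heckeLambda`, real on newforms), Petersson pairs the eigenvalues directly (no
Hecke relations needed): with `H_N(ℓ,ℓ′) = Σ^h_{f ∈ H_2(N)} ω_f λ_f(ℓ)λ_f(ℓ′)` (= Kowalski–Michel's
`pet N ℓ ℓ′`) and `2H⁻_N(ℓ,ℓ′) = Δ⁻(ℓ,ℓ′)`,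
`Σ^h ω_f A_f² = Σ_{ℓ,ℓ′} c_ℓ c_{ℓ′} H(ℓ,ℓ′)`, `Σ^h_{odd} ω_f A_f² = Σ_{ℓ,ℓ′} c_ℓ c_{ℓ′} H⁻(ℓ,ℓ′)`, and the
typed facts `kowalskiMichel2000_petersson` (`H(ℓ,ℓ′) = δ + O((ℓℓ′)^{3/2} q^{−3/2})`) and
`kowalskiMichel2000_lemma1` (`2H⁻(ℓ,ℓ′) = δ + O((ℓℓ′)^{3/2} q^{−1})`, `ℓ′ ≤ q`) give, by Cauchy–Schwarz
`(Σ|c_ℓ|ℓ^{3/2})² ≤ (Σ c_ℓ²)(Σ_{ℓ∈S} ℓ³)`: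
`|Σ^h ωA² − Σc²| ≤ C₁ q^{−3/2}(Σ_S ℓ³)Σc²`, `|2Σ^h_{odd} ωA² − Σc²| ≤ C₂ q^{−1}(Σ_S ℓ³)Σc²`. Hence for
amplifiers with `Σ_{ℓ ∈ S_q} ℓ³ = o(q)` (`SublinearCubes`; this covers every amplifier supported on
`ℓ ≤ q^a` with `a < 1/4`, since then `Σ ℓ³ ≤ q^{4a}` — `sublinearCubes_of_support_le_rpow`) and
`Σ c² > 0`: total amplified mass `∈ [7/8, 9/8]·Σc²`, even amplified mass `≥ ¼Σc² ≥ ⅕·total` at all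
large prime levels — `CentralValueFamily.EvenShare` for the prime-level, non-trivial-twist
refinement of `iwaniecSarnakFamilyAmp 2 (linAmp S c)` (`evenShare_ampPrimeFamilyTwo`).

WHAT THIS IS NOT: no claim about amplified proportions of (7.5)/(7.6), nor about Landau–Siegel
zeros. «The programme SEARCHES and TYPES; no claim about Landau–Siegel zeros, Theorems 1–2 of
arXiv:2211.02515 or a repaired Margin232 until a kernel theorem says so.»

## References

* [KowalskiMichel2000] Acta Arith. 94 (2000), §2.3 display after (16), Lemma 1 (typed facts
  `KowalskiMichel2000.kowalskiMichel2000_petersson`, `kowalskiMichel2000_lemma1`).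
* [IwaniecConversations2006] §7 (7.3) (the harmonic family and its mass).
* [Shimura1971] proof of Thm. 3.48 (real Fourier coefficients; tree `IsNewform0.cuspCoeff_eq_ofReal_re`).
-/

noncomputable section

namespace Literature.NumberTheory.LFunctions.CentralValueFamilyHalfEdge

open scoped MatrixGroups
open Finset Real CongruenceSubgroup Complex
open Literature.NumberTheory.EllipticCurves.ModularForms
open Literature.NumberTheory.LFunctions.IwaniecSarnak

/-! ## Hecke eigenvalues of newforms are real -/

/-- For a newform on `Γ₀(N)`, `λ_f(n) = a_f(n) n^{−(k−1)/2}` is real: `λ_f(n) = re λ_f(n)` (real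
Fourier coefficients, Shimura; real power of `n`). [cite: Shimura1971, proof of Thm. 3.48] -/
theorem heckeLambda_eq_ofReal_re {N : ℕ} [NeZero N] {k : ℤ} {f : CuspForm (Gamma0 N) k}
    (hf : IsNewform0 f) (n : ℕ) :
    GL2Family.heckeLambda f n = ((GL2Family.heckeLambda f n).re : ℂ) := by
  have hpow : ((n : ℂ) ^ (-(((k : ℂ) - 1) / 2))) = (((n : ℝ) ^ (-(((k : ℝ) - 1) / 2)) : ℝ) : ℂ) := by
    rw [Complex.ofReal_cpow (Nat.cast_nonneg n)]
    push_cast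
    ring_nf
  have ha : (cuspCoeff f n).im = 0 := hf.cuspCoeff_im_eq_zero n
  have hp : ((n : ℂ) ^ (-(((k : ℂ) - 1) / 2))).im = 0 := by rw [hpow]; exact Complex.ofReal_im _
  apply Complex.ext
  · rw [Complex.ofReal_re]
  · rw [Complex.ofReal_im]
    unfold GL2Family.heckeLambda
    rw [Complex.mul_im, ha, hp, mul_zero, zero_mul, add_zero]

/-! ## Linear amplifiers and the Petersson pair sums -/

/-- A **linear amplifier** at each level: `A_N(f) = Σ_{ℓ ∈ S N} c_{N,ℓ} · re λ_f(ℓ)` (support `S N`,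
real coefficients `c N`). [cite: KowalskiMichel2000, §2.3 (definition of M(f))] -/
def linAmp {k : ℤ} (S : ℕ+ → Finset ℕ) (c : ℕ+ → ℕ → ℝ) (N : ℕ+) (f : CuspForm (Gamma0 (N : ℕ)) k) : ℝ :=
  ∑ ℓ ∈ S N, c N ℓ * (GL2Family.heckeLambda f ℓ).re

/-- The real Petersson pair sum `H_N(ℓ,ℓ′) = Σ^h_f ω_f · re λ_f(ℓ) · re λ_f(ℓ′)` over `H_2(N)`.
[cite: KowalskiMichel2000, §2.3 (display after (16))] -/
def pairSum (N : ℕ) [NeZero N] (l m : ℕ) : ℝ :=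
  harmonicSum N 2 (fun f => (GL2Family.heckeLambda f l).re * (GL2Family.heckeLambda f m).re)

open scoped Classical in
/-- The odd-restricted pair sum `H⁻_N(ℓ,ℓ′) = Σ^h_{w_f ≠ 1} ω_f · re λ_f(ℓ) · re λ_f(ℓ′)`.
[cite: KowalskiMichel2000, (14) (definition of Δ⁻)] -/
def pairSumOdd (N : ℕ) [NeZero N] (l m : ℕ) : ℝ :=
  harmonicSum N 2 (fun f => if rootNumber f = 1 then 0 else
    (GL2Family.heckeLambda f l).re * (GL2Family.heckeLambda f m).re)

/-- `pet N ℓ ℓ′ = H_N(ℓ,ℓ′)` (complex vs real harmonic sums; eigenvalues real on newforms).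
[cite: KowalskiMichel2000, §2.3 (display after (16))] -/
theorem pet_eq_pairSum (N : ℕ) [NeZero N] (l m : ℕ) :
    KowalskiMichel2000.pet N l m = ((pairSum N l m : ℝ) : ℂ) := by
  rw [pairSum, KowalskiMichel2000.ofReal_harmonicSum]
  unfold KowalskiMichel2000.pet GL2Family.harmonicSum
  refine finsum_mem_congr rfl fun f hf => ?_
  have hf' : IsNewform0 f := hf
  beta_reduce
  rw [heckeLambda_eq_ofReal_re hf' l, heckeLambda_eq_ofReal_re hf' m]
  push_cast
  simp only [Complex.ofReal_re]

/-- `Δ⁻(ℓ,ℓ′) = 2 H⁻_N(ℓ,ℓ′)`. [cite: KowalskiMichel2000, (14) (definition of Δ⁻)] -/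
theorem deltaMinus_eq_pairSumOdd (N : ℕ) [NeZero N] (l m : ℕ) :
    KowalskiMichel2000.DeltaMinus N l m = 2 * ((pairSumOdd N l m : ℝ) : ℂ) := by
  rw [pairSumOdd, KowalskiMichel2000.ofReal_harmonicSum]
  unfold KowalskiMichel2000.DeltaMinus GL2Family.harmonicSum
  congr 1
  refine finsum_mem_congr rfl fun f hf => ?_
  have hf' : IsNewform0 f := hf
  beta_reduce
  rw [epsMinus_eq_indicator hf, heckeLambda_eq_ofReal_re hf' l, heckeLambda_eq_ofReal_re hf' m]
  simp only [Complex.ofReal_re]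
  split_ifs <;> push_cast <;> ring

/-- **Pair-sum bounds from the Petersson facts**: `|H(ℓ,ℓ′) − δ| ≤ C₁(ℓℓ′)^{3/2}q^{−3/2}` and
`|2H⁻(ℓ,ℓ′) − δ| ≤ C₂(ℓℓ′)^{3/2}q^{−1}` for prime `q`, `1 ≤ ℓ, ℓ′`, `ℓ′ ≤ q`.
[cite: KowalskiMichel2000, §2.3 (display after (16)) and Lemma 1] -/
theorem pairSum_bounds (hP : KowalskiMichel2000.kowalskiMichel2000_petersson)
    (hL : KowalskiMichel2000.kowalskiMichel2000_lemma1) :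
    ∃ C₁ C₂ : ℝ, 0 ≤ C₁ ∧ 0 ≤ C₂ ∧ ∀ (q : ℕ) [NeZero q], q.Prime → ∀ l m : ℕ, 1 ≤ l → 1 ≤ m → m ≤ q →
      |pairSum q l m - (if l = m then 1 else 0)| ≤ C₁ * (((l : ℝ) * m) ^ (3 / 2 : ℝ)) * (q : ℝ) ^ (-(3 / 2 : ℝ)) ∧
      |2 * pairSumOdd q l m - (if l = m then 1 else 0)| ≤ C₂ * (((l : ℝ) * m) ^ (3 / 2 : ℝ)) / q := by
  obtain ⟨C₁, h₁⟩ := hP 1 one_pos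
  obtain ⟨C₂, h₂⟩ := hL 1 one_pos
  have e32 : (1 / 2 + 1 : ℝ) = 3 / 2 := by norm_num
  -- the constants can be taken ≥ 0 (replace by max with 0)
  refine ⟨max C₁ 0, max C₂ 0, le_max_right _ _, le_max_right _ _, fun q _ hq l m hl hm hmq => ⟨?_, ?_⟩⟩
  · have h := h₁ q hq l m hl hm
    rw [pet_eq_pairSum] at h
    have e : (((pairSum q l m : ℝ) : ℂ) - (if l = m then 1 else 0)) =
        (((pairSum q l m - (if l = m then 1 else 0) : ℝ)) : ℂ) := by
      split_ifs <;> push_cast <;> ring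
    rw [e, Complex.norm_real, Real.norm_eq_abs, e32] at h
    refine le_trans h (mul_le_mul_of_nonneg_right (mul_le_mul_of_nonneg_right (le_max_left _ _)
      (by positivity)) (by positivity))
  · have h := h₂ q hq l m hl hm hmq
    rw [deltaMinus_eq_pairSumOdd] at h
    have e : (2 * ((pairSumOdd q l m : ℝ) : ℂ) - (if l = m then 1 else 0)) =
        (((2 * pairSumOdd q l m - (if l = m then 1 else 0) : ℝ)) : ℂ) := by
      split_ifs <;> push_cast <;> ring
    rw [e, Complex.norm_real, Real.norm_eq_abs, e32] at h
    refine le_trans h ?_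
    exact div_le_div_of_nonneg_right (mul_le_mul_of_nonneg_right (le_max_left _ _) (by positivity))
      (by positivity)

/-! ## Expanding the amplified masses -/

section Expand

variable {S : ℕ+ → Finset ℕ} {c : ℕ+ → ℕ → ℝ}

/-- `Σ^h ω_f A_f² = Σ_{ℓ,ℓ′} c_ℓ c_{ℓ′} H(ℓ,ℓ′)`. [cite: KowalskiMichel2000, §2.3 (display after (16))] -/
theorem harmonicSum_linAmp_sq (N : ℕ+) :
    harmonicSum (N : ℕ) 2 (fun f => linAmp (k := 2) S c N f ^ 2) =
      ∑ l ∈ S N, ∑ m ∈ S N, c N l * c N m * pairSum (N : ℕ) l m := by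
  have hfin : (newforms0 (N : ℕ) (2 : ℤ)).Finite := finite_newforms0_holds (N : ℕ) (2 : ℤ)
  unfold pairSum
  simp_rw [harmonicSum_eq_sum hfin]
  have hexp : ∀ f : CuspForm (Gamma0 (N : ℕ)) 2, harmonicWeight f * linAmp (k := 2) S c N f ^ 2 =
      ∑ l ∈ S N, ∑ m ∈ S N, harmonicWeight f *
        (c N l * c N m * ((GL2Family.heckeLambda f l).re * (GL2Family.heckeLambda f m).re)) := by
    intro f
    rw [linAmp, sq, Finset.sum_mul_sum, Finset.mul_sum]
    refine Finset.sum_congr rfl fun l _ => ?_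
    rw [Finset.mul_sum]
    refine Finset.sum_congr rfl fun m _ => ?_
    ring
  rw [Finset.sum_congr rfl fun f _ => hexp f, Finset.sum_comm]
  refine Finset.sum_congr rfl fun l _ => ?_
  rw [Finset.sum_comm]
  refine Finset.sum_congr rfl fun m _ => ?_
  rw [Finset.mul_sum]
  refine Finset.sum_congr rfl fun f _ => ?_
  ring

open scoped Classical in
/-- `Σ^h_{odd} ω_f A_f² = Σ_{ℓ,ℓ′} c_ℓ c_{ℓ′} H⁻(ℓ,ℓ′)`. [cite: KowalskiMichel2000, (14) (definition of Δ⁻)] -/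
theorem harmonicSum_linAmp_sq_odd (N : ℕ+) :
    harmonicSum (N : ℕ) 2 (fun f => if rootNumber f = 1 then 0 else linAmp (k := 2) S c N f ^ 2) =
      ∑ l ∈ S N, ∑ m ∈ S N, c N l * c N m * pairSumOdd (N : ℕ) l m := by
  have hfin : (newforms0 (N : ℕ) (2 : ℤ)).Finite := finite_newforms0_holds (N : ℕ) (2 : ℤ)
  unfold pairSumOdd
  simp_rw [harmonicSum_eq_sum hfin]
  have hexp : ∀ f : CuspForm (Gamma0 (N : ℕ)) 2,
      harmonicWeight f * (if rootNumber f = 1 then 0 else linAmp (k := 2) S c N f ^ 2) =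
      ∑ l ∈ S N, ∑ m ∈ S N, harmonicWeight f * (c N l * c N m *
        (if rootNumber f = 1 then 0 else
          (GL2Family.heckeLambda f l).re * (GL2Family.heckeLambda f m).re)) := by
    intro f
    by_cases hw : rootNumber f = 1
    · simp [hw]
    · simp only [hw, if_false]
      rw [linAmp, sq, Finset.sum_mul_sum, Finset.mul_sum]
      refine Finset.sum_congr rfl fun l _ => ?_
      rw [Finset.mul_sum]
      refine Finset.sum_congr rfl fun m _ => ?_
      ring
  rw [Finset.sum_congr rfl fun f _ => hexp f, Finset.sum_comm]
  refine Finset.sum_congr rfl fun l _ => ?_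
  rw [Finset.sum_comm]
  refine Finset.sum_congr rfl fun m _ => ?_
  rw [Finset.mul_sum]
  refine Finset.sum_congr rfl fun f _ => ?_
  ring

/-- The diagonal: `Σ_{ℓ,ℓ′} c_ℓ c_{ℓ′} δ(ℓ,ℓ′) = Σ c_ℓ²`. [folklore] -/
private theorem sum_sum_delta (N : ℕ+) :
    ∑ l ∈ S N, ∑ m ∈ S N, c N l * c N m * (if l = m then (1 : ℝ) else 0) = ∑ l ∈ S N, c N l ^ 2 := by
  refine Finset.sum_congr rfl fun l hl => ?_
  simp only [mul_ite, mul_one, mul_zero, Finset.sum_ite_eq, if_pos hl, sq]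

/-- **Error control by Cauchy–Schwarz**: if `|X(ℓ,ℓ′) − δ(ℓ,ℓ′)| ≤ K·(ℓℓ′)^{3/2}` on `S × S` then
`|Σ c c′ X − Σ c²| ≤ K · (Σ_{ℓ∈S} ℓ³) · Σ c²`. [folklore] -/
private theorem bilinear_error {X : ℕ → ℕ → ℝ} {K : ℝ} (hK : 0 ≤ K) (N : ℕ+)
    (hX : ∀ l ∈ S N, ∀ m ∈ S N, |X l m - (if l = m then 1 else 0)| ≤ K * (((l : ℝ) * m) ^ (3 / 2 : ℝ))) :
    |∑ l ∈ S N, ∑ m ∈ S N, c N l * c N m * X l m - ∑ l ∈ S N, c N l ^ 2| ≤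
      K * (∑ l ∈ S N, ((l : ℝ)) ^ 3) * ∑ l ∈ S N, c N l ^ 2 := by
  have hsplit : ∑ l ∈ S N, ∑ m ∈ S N, c N l * c N m * X l m - ∑ l ∈ S N, c N l ^ 2 =
      ∑ l ∈ S N, ∑ m ∈ S N, c N l * c N m * (X l m - (if l = m then 1 else 0)) := by
    rw [← sum_sum_delta N, ← Finset.sum_sub_distrib]
    refine Finset.sum_congr rfl fun l _ => ?_
    rw [← Finset.sum_sub_distrib]
    refine Finset.sum_congr rfl fun m _ => ?_
    ring
  rw [hsplit]
  -- |ℓ|^{3/2} weights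
  set w : ℕ → ℝ := fun l => |c N l| * ((l : ℝ)) ^ (3 / 2 : ℝ) with hw
  have hterm : ∀ l ∈ S N, ∀ m ∈ S N,
      |c N l * c N m * (X l m - (if l = m then 1 else 0))| ≤ K * (w l * w m) := by
    intro l hl m hm
    rw [abs_mul, abs_mul]
    have h := hX l hl m hm
    have hlm : (((l : ℝ) * m) ^ (3 / 2 : ℝ)) = ((l : ℝ)) ^ (3 / 2 : ℝ) * ((m : ℝ)) ^ (3 / 2 : ℝ) :=
      Real.mul_rpow (Nat.cast_nonneg l) (Nat.cast_nonneg m)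
    calc |c N l| * |c N m| * |X l m - (if l = m then 1 else 0)|
        ≤ |c N l| * |c N m| * (K * (((l : ℝ) * m) ^ (3 / 2 : ℝ))) :=
          mul_le_mul_of_nonneg_left h (by positivity)
      _ = K * (w l * w m) := by rw [hlm, hw]; ring
  have hbound : |∑ l ∈ S N, ∑ m ∈ S N, c N l * c N m * (X l m - (if l = m then 1 else 0))| ≤
      K * (∑ l ∈ S N, w l) ^ 2 := by
    calc |∑ l ∈ S N, ∑ m ∈ S N, c N l * c N m * (X l m - (if l = m then 1 else 0))|
        ≤ ∑ l ∈ S N, |∑ m ∈ S N, c N l * c N m * (X l m - (if l = m then 1 else 0))| :=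
          Finset.abs_sum_le_sum_abs _ _
      _ ≤ ∑ l ∈ S N, ∑ m ∈ S N, |c N l * c N m * (X l m - (if l = m then 1 else 0))| :=
          Finset.sum_le_sum fun l _ => Finset.abs_sum_le_sum_abs _ _
      _ ≤ ∑ l ∈ S N, ∑ m ∈ S N, K * (w l * w m) :=
          Finset.sum_le_sum fun l hl => Finset.sum_le_sum fun m hm => hterm l hl m hm
      _ = K * (∑ l ∈ S N, w l) ^ 2 := by
          rw [sq, Finset.sum_mul_sum, Finset.mul_sum]
          refine Finset.sum_congr rfl fun l _ => ?_
          rw [Finset.mul_sum]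
  -- Cauchy–Schwarz: (Σ |c| ℓ^{3/2})² ≤ (Σ ℓ³)(Σ c²)
  have hCS : (∑ l ∈ S N, w l) ^ 2 ≤ (∑ l ∈ S N, ((l : ℝ)) ^ 3) * ∑ l ∈ S N, c N l ^ 2 := by
    have h := Finset.sum_mul_sq_le_sq_mul_sq (S N) (fun l => ((l : ℝ)) ^ (3 / 2 : ℝ)) (fun l => |c N l|)
    have e1 : ∀ l ∈ S N, (((l : ℝ)) ^ (3 / 2 : ℝ)) ^ 2 = ((l : ℝ)) ^ 3 := by
      intro l _
      rw [← Real.rpow_natCast, ← Real.rpow_mul (Nat.cast_nonneg l)]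
      norm_num
    have e2 : ∀ l ∈ S N, |c N l| ^ 2 = c N l ^ 2 := fun l _ => sq_abs _
    rw [Finset.sum_congr rfl e1, Finset.sum_congr rfl e2] at h
    have e3 : ∑ l ∈ S N, ((l : ℝ)) ^ (3 / 2 : ℝ) * |c N l| = ∑ l ∈ S N, w l :=
      Finset.sum_congr rfl fun l _ => by rw [hw]; ring
    rw [e3] at h
    exact h
  exact le_trans hbound (by rw [mul_assoc]; exact mul_le_mul_of_nonneg_left hCS hK)

end Expand

/-! ## The amplified prime-level family and its even share -/

/-- **Sublinear cubes**: the amplifier supports satisfy `Σ_{ℓ ∈ S_N} ℓ³ = o(N)` along the levels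
(e.g. support in `ℓ ≤ N^{1/4−ε}`), and `S_N ⊆ [1, N]`. [cite: KowalskiMichel2000, Lemma 1 (range m ≤ q)] -/
def SublinearCubes (S : ℕ+ → Finset ℕ) : Prop :=
  (∀ N : ℕ+, ∀ l ∈ S N, 1 ≤ l ∧ l ≤ (N : ℕ)) ∧
    ∀ ε : ℝ, 0 < ε → ∃ N₀ : ℕ, ∀ N : ℕ+, N₀ ≤ (N : ℕ) → ∑ l ∈ S N, ((l : ℝ)) ^ 3 ≤ ε * (N : ℕ)

/-- **The amplified weight-2 family at prime levels with non-trivial twists**: `𝓗_2(N)` under the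
measure `ω_f A_f²`, `A = linAmp S c`, admissibility restricted to PRIME levels and compatibility to
`D > 1` (devices `reweight` and `refine`). [cite: IwaniecConversations2006, §7 (7.1)–(7.6)] -/
abbrev ampPrimeFamilyTwo (S : ℕ+ → Finset ℕ) (c : ℕ+ → ℕ → ℝ) : CentralValueFamily :=
  (iwaniecSarnakFamilyAmp 2 (linAmp S c)).refine (fun N : ℕ+ => (N : ℕ).Prime) (fun D => 1 < D)

/-- The total amplified mass at level `N` is `Σ^h ω_f A_f²`. [cite: IwaniecConversations2006, §7 (7.3)] -/
theorem totalMass_iwaniecSarnakFamilyAmp {k : ℤ} (A : (N : ℕ+) → CuspForm (Gamma0 (N : ℕ)) k → ℝ)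
    (N : ℕ+) :
    (iwaniecSarnakFamilyAmp k A).totalMass N = harmonicSum (N : ℕ) k (fun f => A N f ^ 2) := by
  unfold CentralValueFamily.totalMass harmonicSum
  rw [finsum_mem_eq_finite_toFinset_sum _ (finite_newforms0_holds (N : ℕ) k)]
  rfl

open scoped Classical in
/-- The even amplified mass is the total minus the odd-restricted one. [cite: IwaniecConversations2006, §7 (7.3)] -/
private theorem harmonicSum_even_eq_sub {N : ℕ} [NeZero N] (X : CuspForm (Gamma0 N) 2 → ℝ) :
    harmonicSum N 2 (fun f => if rootNumber f = 1 then X f else 0) =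
      harmonicSum N 2 X - harmonicSum N 2 (fun f => if rootNumber f = 1 then 0 else X f) := by
  have hfin : (newforms0 N (2 : ℤ)).Finite := finite_newforms0_holds N (2 : ℤ)
  rw [harmonicSum_eq_sum hfin, harmonicSum_eq_sum hfin, harmonicSum_eq_sum hfin,
    ← Finset.sum_sub_distrib]
  refine Finset.sum_congr rfl fun f _ => ?_
  split_ifs <;> ring

/-- **Even share of the amplified measure at prime level, weight `2`** (root-number equidistribution
under `ω_f A_f²`): for a linear amplifier with sublinear cubes and `Σ c² > 0`, at all large prime
levels `Σ^h_{even} ω A² ≥ ⅕·Σ^h ω A² > 0` — from the Petersson facts.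
[cite: KowalskiMichel2000, §2.3 (display after (16)) and Lemma 1] -/
theorem evenShare_ampPrimeFamilyTwo {S : ℕ+ → Finset ℕ} {c : ℕ+ → ℕ → ℝ}
    (hP : KowalskiMichel2000.kowalskiMichel2000_petersson)
    (hL : KowalskiMichel2000.kowalskiMichel2000_lemma1) (hS : SublinearCubes S)
    (hc : ∀ N : ℕ+, 0 < ∑ l ∈ S N, c N l ^ 2) : (ampPrimeFamilyTwo S c).EvenShare := by
  classical
  obtain ⟨C₁, C₂, hC₁, hC₂, hB⟩ := pairSum_bounds hP hL
  obtain ⟨hrange, hsub⟩ := hS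
  -- choose ε with C₁ ε ≤ 1/8 and C₂ ε ≤ 1/4
  set ε : ℝ := 1 / (8 * (C₁ + C₂ + 1)) with hεdef
  have hε : 0 < ε := by rw [hεdef]; positivity
  obtain ⟨N₀, hN₀⟩ := hsub ε hε
  refine ⟨1 / 5, by norm_num, ((N₀ : ℝ) + 1),
    fun (N : ℕ+) (hadm : Squarefree (N : ℕ) ∧ (N : ℕ).Prime)
      (hsz : (N₀ : ℝ) + 1 ≤ ((N : ℕ) : ℝ)) => ?_⟩
  obtain ⟨_, hprime⟩ := hadm
  set q : ℕ := (N : ℕ) with hqdef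
  have hq1 : (1 : ℝ) ≤ q := by exact_mod_cast hprime.one_lt.le
  have hqpos : (0 : ℝ) < q := lt_of_lt_of_le one_pos hq1
  have hN₀' : N₀ ≤ q := by exact_mod_cast (by linarith : (N₀ : ℝ) ≤ q)
  have hcube := hN₀ N hN₀'
  -- rewrite the masses
  show 1 / 5 * (iwaniecSarnakFamilyAmp 2 (linAmp S c)).totalMass N ≤
      (iwaniecSarnakFamilyAmp 2 (linAmp S c)).evenMass N ∧
    0 < (iwaniecSarnakFamilyAmp 2 (linAmp S c)).totalMass N
  rw [totalMass_iwaniecSarnakFamilyAmp, evenMass_iwaniecSarnakFamilyAmp, harmonicSum_even_eq_sub,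
    harmonicSum_linAmp_sq, harmonicSum_linAmp_sq_odd]
  set T := ∑ l ∈ S N, ∑ m ∈ S N, c N l * c N m * pairSum q l m with hT
  set O := ∑ l ∈ S N, ∑ m ∈ S N, c N l * c N m * pairSumOdd q l m with hO
  set V := ∑ l ∈ S N, c N l ^ 2 with hV
  set B := ∑ l ∈ S N, ((l : ℝ)) ^ 3 with hBdef
  have hVpos : 0 < V := hc N
  -- total: |T − V| ≤ C₁ q^{-3/2} B V ≤ C₁ ε V ≤ V/8
  have hTerr : |T - V| ≤ C₁ * (q : ℝ) ^ (-(3 / 2 : ℝ)) * B * V := by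
    have h := bilinear_error (S := S) (c := c) (X := fun l m => pairSum q l m)
      (K := C₁ * (q : ℝ) ^ (-(3 / 2 : ℝ))) (by positivity) N (fun l hl m hm => by
        have hb := (hB q hprime l m (hrange N l hl).1 (hrange N m hm).1 (hrange N m hm).2).1
        calc |pairSum q l m - (if l = m then 1 else 0)|
            ≤ C₁ * (((l : ℝ) * m) ^ (3 / 2 : ℝ)) * (q : ℝ) ^ (-(3 / 2 : ℝ)) := hb
          _ = C₁ * (q : ℝ) ^ (-(3 / 2 : ℝ)) * (((l : ℝ) * m) ^ (3 / 2 : ℝ)) := by ring)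
    simpa [hT, hV, hBdef, mul_assoc] using h
  -- odd: |2O − V| ≤ C₂ q^{-1} B V
  have hOerr : |2 * O - V| ≤ C₂ / q * B * V := by
    have h := bilinear_error (S := S) (c := c) (X := fun l m => 2 * pairSumOdd q l m)
      (K := C₂ / q) (by positivity) N (fun l hl m hm => by
        have hb := (hB q hprime l m (hrange N l hl).1 (hrange N m hm).1 (hrange N m hm).2).2
        calc |2 * pairSumOdd q l m - (if l = m then 1 else 0)|
            ≤ C₂ * (((l : ℝ) * m) ^ (3 / 2 : ℝ)) / q := hb
          _ = C₂ / q * (((l : ℝ) * m) ^ (3 / 2 : ℝ)) := by ring)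
    have e : ∑ l ∈ S N, ∑ m ∈ S N, c N l * c N m * (2 * pairSumOdd q l m) = 2 * O := by
      rw [hO, Finset.mul_sum]
      refine Finset.sum_congr rfl fun l _ => ?_
      rw [Finset.mul_sum]
      refine Finset.sum_congr rfl fun m _ => ?_
      ring
    rw [e] at h
    simpa [hV, hBdef, mul_assoc] using h
  -- the two error factors are small
  have hBε : B ≤ ε * q := hcube
  have hsum : 0 < C₁ + C₂ + 1 := by positivity
  have ha : C₁ * (q : ℝ) ^ (-(3 / 2 : ℝ)) * B ≤ 1 / 8 := by
    have hrpow : (q : ℝ) ^ (-(3 / 2 : ℝ)) ≤ (q : ℝ)⁻¹ := by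
      rw [← Real.rpow_neg_one]
      exact Real.rpow_le_rpow_of_exponent_le hq1 (by norm_num)
    calc C₁ * (q : ℝ) ^ (-(3 / 2 : ℝ)) * B ≤ C₁ * (q : ℝ)⁻¹ * (ε * q) := by
          apply mul_le_mul (mul_le_mul_of_nonneg_left hrpow hC₁) hBε (by rw [hBdef]; positivity)
            (by positivity)
      _ = C₁ * ε := by field_simp
      _ ≤ (C₁ + C₂ + 1) * ε := mul_le_mul_of_nonneg_right (by linarith) hε.le
      _ = 1 / 8 := by rw [hεdef]; field_simp
  have hb : C₂ / q * B ≤ 1 / 8 := by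
    calc C₂ / q * B ≤ C₂ / q * (ε * q) := mul_le_mul_of_nonneg_left hBε (by positivity)
      _ = C₂ * ε := by field_simp
      _ ≤ (C₁ + C₂ + 1) * ε := mul_le_mul_of_nonneg_right (by linarith) hε.le
      _ = 1 / 8 := by rw [hεdef]; field_simp
  have hT' : |T - V| ≤ 1 / 8 * V := le_trans hTerr (mul_le_mul_of_nonneg_right ha hVpos.le)
  have hO' : |2 * O - V| ≤ 1 / 8 * V := le_trans hOerr (mul_le_mul_of_nonneg_right hb hVpos.le)
  obtain ⟨hT1, hT2⟩ := abs_le.mp hT'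
  obtain ⟨hO1, hO2⟩ := abs_le.mp hO'
  constructor
  · nlinarith
  · nlinarith

/-- **Amplifiers supported below `N^a`, `a < 1/4`, have sublinear cubes**: if `S_N ⊆ [1, N^a]` then
`Σ_{ℓ ∈ S_N} ℓ³ ≤ N^{4a} = o(N)`. (The amplifier class of the B-fam books: support `ℓ ≤ N^a`, `a < ¼`.)
[cite: KowalskiMichel2000, Lemma 1 (range m ≤ q)] -/
theorem sublinearCubes_of_support_le_rpow {S : ℕ+ → Finset ℕ} {a : ℝ} (ha : a < 1 / 4)
    (hS : ∀ N : ℕ+, ∀ l ∈ S N, 1 ≤ l ∧ (l : ℝ) ≤ ((N : ℕ) : ℝ) ^ a) : SublinearCubes S := by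
  have hle : ∀ N : ℕ+, ∀ l ∈ S N, (l : ℝ) ≤ (N : ℕ) := by
    intro N l hl
    have hN1 : (1 : ℝ) ≤ ((N : ℕ) : ℝ) := by exact_mod_cast Nat.succ_le_of_lt N.pos
    exact le_trans (hS N l hl).2 (by
      simpa using Real.rpow_le_rpow_of_exponent_le hN1 (show a ≤ 1 by linarith))
  refine ⟨fun N l hl => ⟨(hS N l hl).1, by exact_mod_cast hle N l hl⟩, fun ε hε => ?_⟩
  -- Σ_{ℓ ∈ S_N} ℓ³ ≤ |S_N| · N^{3a} ≤ N^a · N^{3a} = N^{4a} ≤ ε N once N^{1−4a} ≥ 1/ε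
  have h4a : 0 < 1 - 4 * a := by linarith
  obtain ⟨M, hM⟩ := exists_nat_gt ((1 / ε) ^ (1 / (1 - 4 * a)))
  refine ⟨M, fun N hN => ?_⟩
  have hx1 : (1 : ℝ) ≤ ((N : ℕ) : ℝ) := by exact_mod_cast Nat.succ_le_of_lt N.pos
  have hNM : (M : ℝ) ≤ ((N : ℕ) : ℝ) := by exact_mod_cast hN
  set x : ℝ := ((N : ℕ) : ℝ) with hx
  have hxpos : 0 < x := lt_of_lt_of_le one_pos hx1
  -- cardinality bound: S_N ⊆ [1, ⌊x^a⌋] so |S_N| ≤ x^a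
  have hcard : ((S N).card : ℝ) ≤ x ^ a := by
    have hsub : S N ⊆ Finset.Icc 1 ⌊x ^ a⌋₊ := by
      intro l hl
      rw [Finset.mem_Icc]
      exact ⟨(hS N l hl).1, Nat.le_floor (hS N l hl).2⟩
    calc ((S N).card : ℝ) ≤ ((Finset.Icc 1 ⌊x ^ a⌋₊).card : ℝ) := by
          exact_mod_cast Finset.card_le_card hsub
      _ = (⌊x ^ a⌋₊ : ℝ) := by simp
      _ ≤ x ^ a := Nat.floor_le (Real.rpow_nonneg hxpos.le a)
  have hterm : ∀ l ∈ S N, ((l : ℝ)) ^ 3 ≤ x ^ (3 * a) := by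
    intro l hl
    have h := (hS N l hl).2
    calc ((l : ℝ)) ^ 3 ≤ (x ^ a) ^ 3 := by
          exact pow_le_pow_left₀ (Nat.cast_nonneg l) h 3
      _ = x ^ (3 * a) := by
          rw [← Real.rpow_natCast, ← Real.rpow_mul hxpos.le]; ring_nf
  have hsum : ∑ l ∈ S N, ((l : ℝ)) ^ 3 ≤ x ^ (4 * a) := by
    calc ∑ l ∈ S N, ((l : ℝ)) ^ 3 ≤ ∑ l ∈ S N, x ^ (3 * a) := Finset.sum_le_sum hterm
      _ = (S N).card * x ^ (3 * a) := by rw [Finset.sum_const, nsmul_eq_mul]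
      _ ≤ x ^ a * x ^ (3 * a) :=
          mul_le_mul_of_nonneg_right hcard (Real.rpow_nonneg hxpos.le _)
      _ = x ^ (4 * a) := by rw [← Real.rpow_add hxpos]; ring_nf
  -- x^{4a} ≤ ε x  ⇔  x^{4a-1} ≤ ε, and x ≥ M > (1/ε)^{1/(1-4a)}
  have hxM : (1 / ε) ^ (1 / (1 - 4 * a)) < x := lt_of_lt_of_le hM hNM
  have hpow : 1 / ε < x ^ (1 - 4 * a) := by
    have h0 : 0 ≤ (1 / ε) ^ (1 / (1 - 4 * a)) := Real.rpow_nonneg (by positivity) _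
    calc 1 / ε = ((1 / ε) ^ (1 / (1 - 4 * a))) ^ (1 - 4 * a) := by
          rw [one_div (1 - 4 * a), Real.rpow_inv_rpow (by positivity) h4a.ne']
      _ < x ^ (1 - 4 * a) := Real.rpow_lt_rpow h0 hxM h4a
  have hfin : x ^ (4 * a) ≤ ε * x := by
    have e : ε * x = ε * x ^ (1 - 4 * a) * x ^ (4 * a) := by
      rw [mul_assoc, ← Real.rpow_add hxpos]; ring_nf; rw [Real.rpow_one]
    rw [e]
    have h1 : 1 ≤ ε * x ^ (1 - 4 * a) := by
      have h2 := hpow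
      rw [div_lt_iff₀ hε] at h2
      linarith [mul_comm (x ^ (1 - 4 * a)) ε]
    calc x ^ (4 * a) = 1 * x ^ (4 * a) := (one_mul _).symm
      _ ≤ ε * x ^ (1 - 4 * a) * x ^ (4 * a) :=
          mul_le_mul_of_nonneg_right h1 (Real.rpow_nonneg hxpos.le _)
  exact le_trans hsum hfin

/-- The prime-level structure of the amplified family (parameters, sizes, admissibility and
compatibility are those of `𝓗_k(N)`; only the weights change). [cite: IwaniecConversations2006, §4 (4.10)] -/
def ampPrimeLevels (k : ℤ) (A : (N : ℕ+) → CuspForm (Gamma0 (N : ℕ)) k → ℝ) :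
    (iwaniecSarnakFamilyAmp k A).PrimeLevels where
  lvl := (iwaniecSarnakPrimeLevels k).lvl
  size_lvl := (iwaniecSarnakPrimeLevels k).size_lvl
  N₀ := (iwaniecSarnakPrimeLevels k).N₀
  admissible := (iwaniecSarnakPrimeLevels k).admissible
  compatible := (iwaniecSarnakPrimeLevels k).compatible

/-- Compatible supply for `ampPrimeFamilyTwo` (Linnik prime levels; `D ≥ 2` eventually). [cite: Linnik1944] -/
theorem ampPrimeFamilyTwo_compatibleSupply (S : ℕ+ → Finset ℕ) (c : ℕ+ → ℕ → ℝ) {δ : ℝ}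
    (hδ : 0 < δ) : ∃ K : ℝ, 0 < K ∧ (ampPrimeFamilyTwo S c).CompatibleSupply δ K :=
  CentralValueFamily.compatibleSupply_refine (ampPrimeLevels 2 (linAmp S c))
    (fun p hp _ => by
      show (max p 1 : ℕ).Prime
      rw [max_eq_left hp.one_lt.le]; exact hp)
    2 (fun _ hD => hD) hδ

/-- **THE AMPLIFIED WEIGHT-2 DECISION THEOREM AT PRIME LEVEL, even share DISCHARGED** (cell request
ls-Bfam-plan 2026-08-26T21:41:31Z; = `CentralValueFamily.lOne_lowerBound_of_EStarFam_total` at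
`ampPrimeFamilyTwo S c` with the binder `EvenShare` supplied by `evenShare_ampPrimeFamilyTwo`).
Remaining binders: the Lapid–Rallis fact, the Petersson facts `kowalskiMichel2000_petersson` /
`kowalskiMichel2000_lemma1`, the amplifier class (`SublinearCubes S`, `Σ c² > 0` — e.g. support
`ℓ ≤ N^a`, `a < ¼`, `c_{N,1} ≠ 0`), and the three DESIGN binders on the amplified measure `ω_f A_f²`:
`MixedOverTotalMass δ` (amplified purity against the total amplified mass, genuine `χ_D`),
`TwistedHalf p₂ 2 δ` (amplified twisted half), `EStarFam p₁ 2` at PRIME levels (amplified edge), with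
`p₁ + p₂ > 1`. Conclusion: `∃ c > 0, L(1,χ_D) ≥ c (log D)⁻⁴` for all large `D`.
[cite: IwaniecConversations2006, §7 (7.7)] -/
theorem lOne_lowerBound_ampPrimeFamilyTwo_total {S : ℕ+ → Finset ℕ} {c : ℕ+ → ℕ → ℝ}
    (hLR : lapidRallis2003_theorem1_gl2Twist)
    (hP : KowalskiMichel2000.kowalskiMichel2000_petersson)
    (hL : KowalskiMichel2000.kowalskiMichel2000_lemma1) (hS : SublinearCubes S)
    (hc : ∀ N : ℕ+, 0 < ∑ l ∈ S N, c N l ^ 2) {p₁ p₂ δ : ℝ} (hδ : 0 < δ)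
    (htot : (iwaniecSarnakFamilyAmp 2 (linAmp S c)).MixedOverTotalMass δ)
    (htw : (iwaniecSarnakFamilyAmp 2 (linAmp S c)).TwistedHalf p₂ 2 δ)
    (hE : (ampPrimeFamilyTwo S c).EStarFam p₁ 2) (hp : 1 < p₁ + p₂) :
    ∃ c₀ : ℝ, 0 < c₀ ∧ ∃ D₀ : ℕ, ∀ (D : ℕ) [NeZero D] (χ : DirichletCharacter ℂ D), D₀ ≤ D →
      χ.IsPrimitive → MulChar.IsQuadratic χ →
        c₀ * ((Real.log D) ^ 4)⁻¹ ≤ (χ.LFunction 1).re := by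
  obtain ⟨K, hK, hsup⟩ := ampPrimeFamilyTwo_compatibleSupply S c hδ
  have h := (ampPrimeFamilyTwo S c).lOne_lowerBound_of_EStarFam_total' hK
    (CentralValueFamily.refine_nonnegOn (iwaniecSarnakFamilyAmp_nonnegOn (linAmp S c) le_rfl hLR))
    (fun _ _ _ _ hcomp => CentralValueFamily.refine_compatible_B hcomp)
    (evenShare_ampPrimeFamilyTwo hP hL hS hc)
    (CentralValueFamily.refine_mixedOverTotalMass htot) (CentralValueFamily.refine_twistedHalf htw)
    hE hp hsup
  simpa only [show (2 * 2 : ℕ) = 4 from rfl] using h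

/-- The amplified edge at all squarefree levels implies the prime-level amplified edge.
[cite: IwaniecConversations2006, §7 (7.5)] -/
theorem ampPrimeFamilyTwo_EStarFam_of_amp {S : ℕ+ → Finset ℕ} {c : ℕ+ → ℕ → ℝ} {p : ℝ}
    (h : (iwaniecSarnakFamilyAmp 2 (linAmp S c)).EStarFam p 2) : (ampPrimeFamilyTwo S c).EStarFam p 2 :=
  CentralValueFamily.refine_EStarFam h

end Literature.NumberTheory.LFunctions.CentralValueFamilyHalfEdge

end
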